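import Summits.AtomisticToContinuum.Crystallization.Theorems.OverbindingBudgetMisfitWindowLayer

/-!
# OverbindingBudget — «MisfitWindow», part 3/3: the glue with the window absorbed; the rim leaf `NearChargeGap` is DISCHARGED; cone XLIV
(decomp-a2c lens-4, generation 39)

Helper file (`--supports stmt-AtomisticToContinuum-31280`); imports part 2 (`…MisfitWindowLayer`), hence part 1 (`…MisfitWindowStatements`).

THE NODE (all seams PROVED; parts 1–3):

    RDEF ⟸ CEG ∧ TameMisfitGap (122/125) 0 ∧ CleanlessExcessT ∧ CoherentResidual 10                                   (cone XLI-W, `rdef_of_ceg_tameMisfitGap`)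
    TameMisfitGap a 0  ⟸  TameScaleGap a 0 ∧ GapFreeShells          TameMisfitGap a s ⟸ TameScaleGap a s ∧ GapEnergyGap a s        (part 1 §C)
    TameScaleGap a s  ⟸  TwoShellShape (1/100) ε g ∧ RegisteredScaleGap a s ρ ε g                  (part 1 §E, PURE PACKING, every ρ ≥ 0)

so that the seven-slot cone XLIII of g38 loses its rim slot `NearChargeGap (33/2)` with NOTHING in its place:

    CONE XLIV:  RobustDefectLimitWindows ⟸ ChargedEnergyGap ∧ TwoShellShape (1/100) (3/50) (1/450) ∧ RegisteredScaleGap (122/125) 0 4 (3/50) (1/450)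
                                           ∧ GapFreeShells ∧ CleanlessExcessT ∧ CoherentResidual 10            (`rdef_of_ceg_shape_registered_gapFree`).

THE GLUE (§G, `misfitRelax_of_tameMisfitGap : TameMisfitGap a 0 → MisfitRelax a`, `0 ≤ a ≤ 1`) is the g37 glue
`misfitRelax_of_misfitEnergyGap` re-proved with the census instantiated at the window `[min δ 2, 2]` (`δ` the separation constant of the
texture) and the off-window rebate paid from the boundary layer by part 2's `offCount_chunk_le` (`#off ≤ Λ ℓ²`, `Λ = 54(4/δ+1)/δ²`,
`C⁺ Λ ℓ² ≤ κ ℓ³` once `ℓ ≥ C⁺Λ/κ`); `κ := c/(40 s³)`, five `κℓ³` budget items.  STRENGTH: `MEG ⇒ TameMisfitGap`, `SEG ⇒ TameScaleGap` (part 1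
§C), so cone XLI-W is implied by the cut of record XLI slot by slot; no converse is claimed.  Reference-free; axioms standard.
-/

namespace Summit.AtomisticToContinuum.Crystallization.Theorems.OverbindingBudgetMisfitWindow

open Filter Metric Set Topology
open scoped BigOperators
open Literature.MathematicalPhysics.StatisticalMechanics
open Literature.Geometry.DiscreteGeometry (IsChargeFree bondGraph nearestDist nearestDist_le_dist nearestDist_nonneg le_nearestDist bondGraph_adj)
open Summit.AtomisticToContinuum.Crystallization.Theses.OverbindingBudget (RobustDefectLimitWindows)
open Summit.AtomisticToContinuum.Crystallization.Theses.PricedLinkCensus (ChargedEnergyGap)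
open Summit.AtomisticToContinuum.Crystallization.Theorems.OverbindingBudgetCubeTails (card_le_of_separated_of_box)
open Summit.AtomisticToContinuum.Crystallization.Theorems.OverbindingBudgetGradedBareness (CleanlessExcessT)
open Summit.AtomisticToContinuum.Crystallization.Theorems.OverbindingBudgetCoherentCut (CoherentResidual)
open Summit.AtomisticToContinuum.Crystallization.Theorems.OverbindingBudgetViolatorDensityFloor (RT)
open Summit.AtomisticToContinuum.Crystallization.Theorems.OverbindingBudgetRecurrentDustStatements (ViolatorsL rt_mono window_finite
  window_finite_lt)
open Summit.AtomisticToContinuum.Crystallization.Theorems.OverbindingBudgetBindingSignLaw (grid_lower_bound)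
open Summit.AtomisticToContinuum.Crystallization.Theorems.OverbindingBudgetExcessInstability (finite_inter_cube)
open Summit.AtomisticToContinuum.Crystallization.Theorems.OverbindingBudgetEdgeRelaxationStatements (CleanClass StrainedCubes)
open Summit.AtomisticToContinuum.Crystallization.Theorems.OverbindingBudgetElasticSplitStatements (chargedCount DenseCharge SparseCharge)
open Summit.AtomisticToContinuum.Crystallization.Theorems.OverbindingBudgetElasticSplitPricing (rpow_two_thirds_le
  two_mul_interactionEnergy_eq_sum_sum_image groundStateEnergy_le_eventually)
open Summit.AtomisticToContinuum.Crystallization.Theorems.OverbindingBudgetGrossMargin (GrossLiouvilleLaw)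
open Summit.AtomisticToContinuum.Crystallization.Theorems.OverbindingBudgetMisfitCensusStatements (Bad Short Long Gap badCount scaleCount
  gapCount MisfitEnergyGap ScaleEnergyGap GapEnergyGap GapFreeShells bad_cases badCount_le_scaleCount_add_gapCount
  badCount_le_scaleCount_of_gapFree rt_of_local card_le_of_cube MisfitRelax)
open Summit.AtomisticToContinuum.Crystallization.Theorems.OverbindingBudgetMisfitCensus (rdef_of_ceg_misfitRelax
  grossLiouvilleLaw_of_misfitRelax)
open Summit.AtomisticToContinuum.Crystallization.Theorems.OverbindingBudgetMisfitRegistration (Framed Reg DeepReg NearCharge regScaleCount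
  unregCount nearChargeCount RegisteredScaleGap NearChargeGap nearCharge_of_not_framed nearCharge_of_not_deepReg)
open Summit.AtomisticToContinuum.Crystallization.Theorems.OverbindingBudgetTwoShellShape (TwoShellShape)
open Summit.AtomisticToContinuum.Crystallization.Theorems.OverbindingBudgetMisfitWindowStatements (InWindow offCount rimCount ScaleEnergyGapW
  MisfitEnergyGapW GapEnergyGapW TameScaleGap TameMisfitGap tameScaleGap_of_scaleEnergyGap tameMisfitGap_of_misfitEnergyGap
  tameMisfitGap_of_tameScale_gap tameMisfitGap_zero_of_tameScale_gapFree tameScaleGap_of_registered scaleEnergyGapW_of_registered)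
open Summit.AtomisticToContinuum.Crystallization.Theorems.OverbindingBudgetMisfitWindowLayer (offCount_chunk_le)

/-! ## §G  The glue with the window absorbed (PROVED) -/

set_option maxHeartbeats 800000 in
/-- **The glue: `TameMisfitGap a 0 → MisfitRelax a`** (`0 ≤ a ≤ 1`).  As `misfitRelax_of_misfitEnergyGap` (g37): violators are margin-`0`
violators; the grid lemma gives them density `(8s³)⁻¹` in every cube of side `n s + 4`; two units inside they are violators of the chunk's own
census, hence BAD or CHARGED; sparse charge bounds the charged ones; the census prices the bad ones; `crysEnergyLimit` and packing close the
estimate — NOW with the census instantiated at the window `[min δ 2, 2]` (`δ` the separation constant of `Y`) and its off-window rebate paid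
from the boundary layer: every chunk site has `nn ≥ min δ 2`, every chunk site two units inside the cube has `nn ≤ 19/10 ≤ 2` (the
`9/10`-covering witness of `y_i + e₀` is another chunk site), and the layer holds `≤ Λ ℓ²` sites (six slabs, `card_le_of_slab`), `Λ ℓ² C⁺ ≤ κ ℓ³`
for `ℓ ≥ C⁺Λ/κ`; `κ := c/(40 s³)` (five `κℓ³` budget items). [this file] -/
theorem misfitRelax_of_tameMisfitGap {a : ℝ} (ha0 : 0 ≤ a) (ha1 : a ≤ 1) (hM : TameMisfitGap a 0) : MisfitRelax a := by
  classical
  intro Y hUD hcov hSp t ht L hV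
  have hUD' := hUD
  obtain ⟨δ₀, hδ₀, hsep₀⟩ := hUD'
  -- the separation constant, capped at `2`
  set δ : ℝ := min δ₀ 2 with hδdef
  have hδ : 0 < δ := lt_min hδ₀ two_pos
  have hδ2 : δ ≤ 2 := min_le_right _ _
  have hsep : ∀ z ∈ Y, ∀ w ∈ Y, z ≠ w → δ ≤ dist z w := fun z hz w hw hzw => (min_le_left _ _).trans (hsep₀ z hz w hw hzw)
  clear_value δ
  obtain ⟨c, C, hc, hgap⟩ := hM δ hδ hδ2
  set e : ℝ := ⨅ Q : PeriodicConfiguration 3, Q.energyPerParticle lennardJones with he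
  -- the grid scale
  set L' : ℝ := max L 0 with hL'
  set s : ℝ := 2 * L' + 2 with hs
  have hL'0 : 0 ≤ L' := le_max_right L 0
  have hs2 : 2 ≤ s := by rw [hs]; linarith
  have hs0 : 0 < s := by linarith
  -- the violator indicator is heavy at scale `s`
  set g : EuclideanSpace ℝ (Fin 3) → ℝ := fun y => if RT a 0 Y y then 0 else 1 with hg
  have hg0 : ∀ y ∈ Y, (0 : ℝ) ≤ g y := by
    intro y _
    simp only [hg]
    split_ifs <;> norm_num
  have hheavy : ∀ z : EuclideanSpace ℝ (Fin 3), ∃ q ∈ Y, dist q z < s / 2 ∧ (1 : ℝ) ≤ g q := by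
    intro z
    obtain ⟨w, hw, hzw⟩ := hcov z
    obtain ⟨y, hy, hyw, hviol⟩ := hV w hw
    refine ⟨y, hy, ?_, ?_⟩
    · calc dist y z ≤ dist y w + dist w z := dist_triangle _ _ _
        _ < s / 2 := by rw [dist_comm w z, hs]; linarith [le_max_left L 0]
    · have hv : ¬ RT a 0 Y y := fun h0 =>
        hviol (t / 2) (by linarith) (by linarith) (rt_mono hUD (by linarith) h0)
      simp only [hg, if_neg hv, le_refl]
  -- constants
  set B : ℝ := 27 / δ ^ 3 with hB
  have hBpos : 0 < B := by positivity
  -- the boundary-layer constant: `#layer ≤ Λ ℓ²`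
  set Λ : ℝ := 54 * (4 / δ + 1) / δ ^ 2 with hΛ
  have hΛpos : 0 < Λ := by positivity
  set Cp : ℝ := max C 0 with hCp
  have hCp0 : 0 ≤ Cp := le_max_right _ _
  have hCle : C ≤ Cp := le_max_left _ _
  set κ : ℝ := c / (40 * s ^ 3) with hκ
  have hκpos : 0 < κ := by positivity
  set ε : ℝ := κ / B with hε
  have hεpos : 0 < ε := by positivity
  obtain ⟨N₁, -, hN₁⟩ := groundStateEnergy_le_eventually hεpos
  rw [← he] at hN₁
  have hcCp : 0 < c + Cp := by linarith
  set ρ : ℝ := κ / (c + Cp) with hρ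
  have hρpos : 0 < ρ := by positivity
  set M : ℝ := Cp * B / κ + 1 with hM
  have hMpos : 0 < M := by positivity
  set Mo : ℝ := Cp * Λ / κ with hMo
  have hMo0 : 0 ≤ Mo := by positivity
  -- sparse charge at density `ρ`
  have hSρ := hSp ρ hρpos
  unfold DenseCharge at hSρ
  push Not at hSρ
  obtain ⟨ℓc, hℓc⟩ := hSρ
  refine ⟨κ, hκpos, ?_⟩
  intro ℓ₀
  -- the side `ℓ = n s + 4`, `n` large
  obtain ⟨n, hn⟩ := exists_nat_ge (max (max (max (max ℓ₀ ℓc) (max (N₁ : ℝ) M)) (max 2 δ)) Mo)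
  simp only [max_le_iff] at hn
  obtain ⟨⟨⟨⟨hnℓ₀, hnℓc⟩, hnN₁, hnM⟩, hn2, hnδ⟩, hnMo⟩ := hn
  have hn1 : (1 : ℝ) ≤ n := by linarith
  have hns : (n : ℝ) ≤ n * s := le_mul_of_one_le_right (by linarith) (by linarith)
  have hns4 : (4 : ℝ) ≤ n * s := by
    have h := mul_le_mul hn2 hs2 (by norm_num) (by linarith : (0 : ℝ) ≤ n)
    linarith
  set ℓ : ℝ := n * s + 4 with hℓ
  have hℓns : ℓ ≤ 2 * (n * s) := by rw [hℓ]; linarith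
  have hℓpos : 0 < ℓ := by rw [hℓ]; linarith
  have hℓ₀ℓ : ℓ₀ ≤ ℓ := by rw [hℓ]; linarith
  have hℓcℓ : ℓc ≤ ℓ := by rw [hℓ]; linarith
  have hℓδ : δ ≤ ℓ := by rw [hℓ]; linarith
  have hℓMo : Mo ≤ ℓ := by rw [hℓ]; linarith
  -- outer corner `o = (-2,-2,-2)`, inner corner `0`
  set o : EuclideanSpace ℝ (Fin 3) := WithLp.toLp 2 (fun _ : Fin 3 => (-2 : ℝ)) with ho
  have hoi : ∀ i : Fin 3, o i = -2 := fun i => rfl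
  have h0i : ∀ i : Fin 3, (0 : EuclideanSpace ℝ (Fin 3)) i = 0 := fun i => rfl
  clear_value L' s B Λ Cp κ ε ρ M Mo ℓ o e g
  -- the chunk, enumerated
  have hfin : (Y ∩ {z | ∀ i : Fin 3, o i ≤ z i ∧ z i < o i + ℓ}).Finite := finite_inter_cube hUD o hℓpos.le
  obtain ⟨N, y, hy, hr⟩ := hfin.fin_param
  set F : Finset (EuclideanSpace ℝ (Fin 3)) := Finset.univ.image y with hF
  have hFcoe : (↑F : Set (EuclideanSpace ℝ (Fin 3))) = Y ∩ {z | ∀ i : Fin 3, o i ≤ z i ∧ z i < o i + ℓ} := by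
    rw [hF, Finset.coe_image, Finset.coe_univ, Set.image_univ, hr]
  have hFcard : F.card = N := by
    rw [hF, Finset.card_image_of_injective _ hy, Finset.card_univ, Fintype.card_fin]
  have hmem : ∀ z ∈ F, z ∈ Y ∧ ∀ i : Fin 3, o i ≤ z i ∧ z i < o i + ℓ := by
    intro z hz
    have hz' : z ∈ (↑F : Set (EuclideanSpace ℝ (Fin 3))) := hz
    rw [hFcoe] at hz'
    exact hz'
  have hU : 1 / 2 * ∑ x ∈ F, ∑ z ∈ F, lennardJones (dist x z) = interactionEnergy lennardJones y := by
    have h2 := two_mul_interactionEnergy_eq_sum_sum_image hy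
    rw [← hF] at h2
    linarith
  -- the inner chunk
  set Fi : Finset (EuclideanSpace ℝ (Fin 3)) :=
    F.filter (fun z => ∀ i : Fin 3, (0 : EuclideanSpace ℝ (Fin 3)) i ≤ z i ∧ z i < (0 : EuclideanSpace ℝ (Fin 3)) i + n * s) with hFi
  have hFicoe : (↑Fi : Set (EuclideanSpace ℝ (Fin 3))) =
      Y ∩ {z | ∀ i : Fin 3, (0 : EuclideanSpace ℝ (Fin 3)) i ≤ z i ∧ z i < (0 : EuclideanSpace ℝ (Fin 3)) i + n * s} := by
    ext z
    simp only [hFi, Finset.coe_filter, Set.mem_setOf_eq, Set.mem_inter_iff]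
    constructor
    · rintro ⟨hzF, hzi⟩
      exact ⟨(hmem z hzF).1, hzi⟩
    · rintro ⟨hzY, hzi⟩
      refine ⟨?_, hzi⟩
      have hzF : z ∈ (↑F : Set (EuclideanSpace ℝ (Fin 3))) := by
        rw [hFcoe]
        refine ⟨hzY, fun i => ?_⟩
        have h := hzi i
        rw [h0i] at h
        rw [hoi, hℓ]
        constructor <;> linarith [h.1, h.2]
      exact hzF
  clear_value F Fi
  -- violators of `Y` two units inside the cube are BAD or CHARGED in the chunk's own census: at least `n³` of them
  have hviol : (n : ℝ) ^ 3 ≤ (badCount a 0 y : ℝ) + (chargedCount y : ℝ) := by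
    have hgrid : (n : ℝ) ^ 3 * 1 ≤ ∑ z ∈ Fi, g z := grid_lower_bound g hg0 hs0 hheavy n 0 Fi hFicoe
    have hsum : ∑ z ∈ Fi, g z = (((Fi.filter (fun z => ¬ RT a 0 Y z)).card : ℕ) : ℝ) := by
      rw [Finset.card_filter]
      push_cast
      refine Finset.sum_congr rfl (fun z _ => ?_)
      by_cases h : RT a 0 Y z <;> simp [hg, h]
    -- locality: a violator of `Y` two units inside the cube is a violator of the chunk
    have hviolF : (Fi.filter (fun z => ¬ RT a 0 Y z)).card ≤
        (Finset.univ.filter (fun i : Fin N => ¬ RT a 0 (Set.range y) (y i))).card := by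
      calc (Fi.filter (fun z => ¬ RT a 0 Y z)).card
          ≤ ((Finset.univ.filter (fun i : Fin N => ¬ RT a 0 (Set.range y) (y i))).image y).card := by
            apply Finset.card_le_card
            intro z hz
            rw [Finset.mem_filter] at hz
            obtain ⟨hzFi, hzv⟩ := hz
            rw [hFi, Finset.mem_filter] at hzFi
            obtain ⟨hzF, hzin⟩ := hzFi
            rw [hF, Finset.mem_image] at hzF
            obtain ⟨i, -, rfl⟩ := hzF
            refine Finset.mem_image.2 ⟨i, Finset.mem_filter.2 ⟨Finset.mem_univ _, fun hRT => hzv ?_⟩, rfl⟩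
            refine rt_of_local hUD (by rw [hr]; exact Set.inter_subset_left) (fun w hw hd => ?_) ha0 hRT
            rw [hr]
            refine ⟨hw, fun k => ?_⟩
            have hk : |(y i) k - w k| ≤ dist (y i) w := by
              rw [← Real.dist_eq]
              exact PiLp.dist_apply_le (y i) w k
            have hd2 : dist (y i) w < 2 := by linarith
            have hzk := hzin k
            rw [h0i] at hzk
            rw [hoi, hℓ]
            have habs := abs_lt.1 (lt_of_le_of_lt hk hd2)
            constructor <;> linarith [habs.1, habs.2, hzk.1, hzk.2]
        _ ≤ _ := Finset.card_image_le
    -- census: a violator of the chunk is bad or charged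
    have hsplit : (Finset.univ.filter (fun i : Fin N => ¬ RT a 0 (Set.range y) (y i))).card ≤ badCount a 0 y + chargedCount y := by
      simp only [badCount, chargedCount, Nat.card_eq_fintype_card, Fintype.card_subtype]
      calc (Finset.univ.filter (fun i : Fin N => ¬ RT a 0 (Set.range y) (y i))).card
          ≤ ((Finset.univ.filter fun i => Bad a 0 y i) ∪ (Finset.univ.filter fun i => ¬ IsChargeFree (1 / 100 : ℝ) y i)).card := by
            apply Finset.card_le_card
            intro i hi
            rw [Finset.mem_filter] at hi
            rw [Finset.mem_union, Finset.mem_filter, Finset.mem_filter]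
            by_cases hcf : IsChargeFree (1 / 100 : ℝ) y i
            · exact Or.inl ⟨hi.1, hcf, hi.2⟩
            · exact Or.inr ⟨hi.1, hcf⟩
        _ ≤ _ := Finset.card_union_le _ _
    have h1 : (n : ℝ) ^ 3 ≤ (((Fi.filter (fun z => ¬ RT a 0 Y z)).card : ℕ) : ℝ) := by linarith [hgrid, hsum]
    have h2 : (((Fi.filter (fun z => ¬ RT a 0 Y z)).card : ℕ) : ℝ) ≤ (badCount a 0 y : ℝ) + (chargedCount y : ℝ) := by
      exact_mod_cast hviolF.trans hsplit
    linarith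
  -- bad and charged sites are disjoint: `#bad + #charged ≤ N`
  have hsumN : (badCount a 0 y : ℝ) + (chargedCount y : ℝ) ≤ N := by
    have h : badCount a 0 y + chargedCount y ≤ N := by
      simp only [badCount, chargedCount, Nat.card_eq_fintype_card, Fintype.card_subtype]
      have h1 : (Finset.univ.filter fun i : Fin N => Bad a 0 y i).card ≤
          (Finset.univ.filter fun i : Fin N => IsChargeFree (1 / 100 : ℝ) y i).card :=
        Finset.card_le_card fun i hi => by
          rw [Finset.mem_filter] at hi ⊢
          exact ⟨hi.1, hi.2.1⟩
      have h2 := Finset.card_filter_add_card_filter_not (s := (Finset.univ : Finset (Fin N)))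
        (fun i : Fin N => IsChargeFree (1 / 100 : ℝ) y i)
      rw [Finset.card_univ, Fintype.card_fin] at h2
      omega
    exact_mod_cast h
  -- counts
  have hcc : (chargedCount y : ℝ) < ρ * ℓ ^ 3 := hℓc ℓ hℓcℓ o N y hy hr
  have hccN : (chargedCount y : ℝ) ≤ N := by
    have h1 : chargedCount y ≤ Nat.card (Fin N) := Finite.card_subtype_le _
    rw [Nat.card_eq_fintype_card, Fintype.card_fin] at h1
    exact_mod_cast h1
  have hbadN : (badCount a 0 y : ℝ) ≤ N := by
    have h1 : badCount a 0 y ≤ Nat.card (Fin N) := Finite.card_subtype_le _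
    rw [Nat.card_eq_fintype_card, Fintype.card_fin] at h1
    exact_mod_cast h1
  have hNn : (n : ℝ) ^ 3 ≤ N := hviol.trans hsumN
  have hNB : (N : ℝ) ≤ B * ℓ ^ 3 := by
    rw [← hFcard, hB]
    exact card_le_of_cube hδ hℓδ (fun z hz => (hmem z hz).2) (fun z hz w hw hzw => hsep z (hmem z hz).1 w (hmem w hw).1 hzw)
  have hnn3 : (n : ℝ) ≤ (n : ℝ) ^ 3 := le_self_pow₀ hn1 (by norm_num)
  have hN₁N : N₁ ≤ N := by exact_mod_cast hnN₁.trans (hnn3.trans hNn)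
  have hNM : M ^ 3 ≤ (N : ℝ) := (pow_le_pow_left₀ hMpos.le hnM 3).trans hNn
  -- ### NEW (g39): the off-window sites of the chunk lie in its boundary layer, `#off ≤ Λ ℓ²` (part 2, `offCount_chunk_le`)
  have hN2 : 2 ≤ N := by
    have h8 : (2 : ℝ) ^ 3 ≤ (n : ℝ) ^ 3 := pow_le_pow_left₀ (by norm_num) hn2 3
    have h2 : (2 : ℝ) ≤ N := by linarith [hNn]
    exact_mod_cast h2
  have hoffN : (offCount δ 2 y : ℝ) ≤ Λ * ℓ ^ 2 := by
    rw [hΛ]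
    exact offCount_chunk_le (m := (n : ℝ) * s) hδ hℓδ hsep hcov hoi hℓ hy hr hN2
  -- the two energy bounds
  have hE : groundStateEnergy lennardJones 3 N ≤ (e + ε) * N := hN₁ N hN₁N
  have hG : (N : ℝ) * e + c * (badCount a 0 y : ℝ) - C * (chargedCount y : ℝ) - C * (offCount δ 2 y : ℝ) - C * (N : ℝ) ^ (2 / 3 : ℝ) ≤
      interactionEnergy lennardJones y := hgap N y hy
  -- error terms
  have hN0 : (0 : ℝ) ≤ N := Nat.cast_nonneg N
  have hrpow : (N : ℝ) ^ (2 / 3 : ℝ) ≤ N / M := rpow_two_thirds_le hMpos hNM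
  have hrpow0 : 0 ≤ (N : ℝ) ^ (2 / 3 : ℝ) := Real.rpow_nonneg hN0 _
  have hcc0 : (0 : ℝ) ≤ chargedCount y := Nat.cast_nonneg _
  have herr0 : C * (chargedCount y : ℝ) ≤ Cp * (chargedCount y : ℝ) := mul_le_mul_of_nonneg_right hCle hcc0
  have herr1 : C * (N : ℝ) ^ (2 / 3 : ℝ) ≤ κ * ℓ ^ 3 := by
    have h1 : C * (N : ℝ) ^ (2 / 3 : ℝ) ≤ Cp * (N : ℝ) ^ (2 / 3 : ℝ) := mul_le_mul_of_nonneg_right hCle hrpow0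
    have h2 : Cp * (N : ℝ) ^ (2 / 3 : ℝ) ≤ Cp * (N / M) := mul_le_mul_of_nonneg_left hrpow hCp0
    have h3 : Cp * (N / M) ≤ Cp * (B * ℓ ^ 3 / M) :=
      mul_le_mul_of_nonneg_left (div_le_div_of_nonneg_right hNB hMpos.le) hCp0
    have h4 : Cp * (B * ℓ ^ 3 / M) ≤ κ * ℓ ^ 3 := by
      have h5 : Cp * B ≤ κ * M := by
        rw [hM, mul_add, mul_div_cancel₀ _ (ne_of_gt hκpos)]
        linarith
      have hl3 : 0 ≤ ℓ ^ 3 := by positivity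
      rw [show Cp * (B * ℓ ^ 3 / M) = Cp * B / M * ℓ ^ 3 by field_simp]
      apply mul_le_mul_of_nonneg_right _ hl3
      rw [div_le_iff₀ hMpos]
      linarith
    linarith
  have herr2 : ε * N ≤ κ * ℓ ^ 3 := by
    have h1 : ε * N ≤ ε * (B * ℓ ^ 3) := mul_le_mul_of_nonneg_left hNB hεpos.le
    have h2 : ε * (B * ℓ ^ 3) = κ * ℓ ^ 3 := by
      rw [hε]
      field_simp
    linarith
  have herr3 : (c + Cp) * (chargedCount y : ℝ) ≤ κ * ℓ ^ 3 := by
    have h1 : (c + Cp) * (chargedCount y : ℝ) ≤ (c + Cp) * (ρ * ℓ ^ 3) := mul_le_mul_of_nonneg_left hcc.le hcCp.le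
    have h2 : (c + Cp) * (ρ * ℓ ^ 3) = κ * ℓ ^ 3 := by
      rw [hρ]
      field_simp
    linarith
  have herrO : C * (offCount δ 2 y : ℝ) ≤ κ * ℓ ^ 3 := by
    have ho0 : (0 : ℝ) ≤ offCount δ 2 y := Nat.cast_nonneg _
    have h1 : C * (offCount δ 2 y : ℝ) ≤ Cp * (offCount δ 2 y : ℝ) := mul_le_mul_of_nonneg_right hCle ho0
    have h2 : Cp * (offCount δ 2 y : ℝ) ≤ Cp * (Λ * ℓ ^ 2) := mul_le_mul_of_nonneg_left hoffN hCp0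
    have h4 : Cp * Λ ≤ κ * ℓ := by
      have h5 := hℓMo
      rw [hMo, div_le_iff₀ hκpos] at h5
      linarith
    have hl2 : (0 : ℝ) ≤ ℓ ^ 2 := by positivity
    nlinarith [mul_le_mul_of_nonneg_right h4 hl2]
  have hmain : 5 * κ * ℓ ^ 3 ≤ c * (n : ℝ) ^ 3 := by
    have hl3 : ℓ ^ 3 ≤ (2 * (n * s)) ^ 3 := pow_le_pow_left₀ hℓpos.le hℓns 3
    have h1 : 5 * κ * ℓ ^ 3 ≤ 5 * κ * (2 * (n * s)) ^ 3 := mul_le_mul_of_nonneg_left hl3 (by positivity)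
    have h2 : 5 * κ * (2 * (n * s)) ^ 3 = c * (n : ℝ) ^ 3 := by
      rw [hκ]
      field_simp
      ring
    linarith
  -- assemble
  refine ⟨ℓ, hℓ₀ℓ, o, F, hFcoe, ?_⟩
  rw [hFcard, hU]
  have hEe : groundStateEnergy lennardJones 3 N ≤ N * e + ε * N := by
    have := hE
    linarith
  have hcbad : c * (n : ℝ) ^ 3 - c * (chargedCount y : ℝ) ≤ c * (badCount a 0 y : ℝ) := by
    have := mul_le_mul_of_nonneg_left (show (n : ℝ) ^ 3 - chargedCount y ≤ badCount a 0 y by linarith) hc.le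
    linarith
  have herr3' : c * (chargedCount y : ℝ) + Cp * (chargedCount y : ℝ) ≤ κ * ℓ ^ 3 := by linarith
  linarith [hEe, hG, herr0, herr1, herr2, herr3', herrO, hmain, hcbad]



/-! ## §H  Consequences and the cones (PROVED) -/

/-- TMG at an admissible spacing gives the gross Liouville law at every margin and core radius. [this file] -/
theorem grossLiouvilleLaw_of_tameMisfitGap {a T₀ D : ℝ} (ha : 47 / 50 ≤ a) (ha1 : a ≤ 1) (h : TameMisfitGap a 0) :
    GrossLiouvilleLaw T₀ D :=
  grossLiouvilleLaw_of_misfitRelax ha ha1 (misfitRelax_of_tameMisfitGap (by linarith) ha1 h)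

/-- The record residual (slot 1 of cone XL) from the TAME misfit census: `TameMisfitGap (122/125) 0 → GrossLiouvilleLaw (1/250) 10`. [this file] -/
theorem grossLiouvilleLaw_record_of_tameMisfitGap (h : TameMisfitGap (122 / 125) 0) : GrossLiouvilleLaw (1 / 250) 10 :=
  grossLiouvilleLaw_of_tameMisfitGap (by norm_num) (by norm_num) h

/-- **CONE XLI-W (four slots, slot 2 KERNEL-WEAKER than MEG)** — `ChargedEnergyGap → TameMisfitGap (122/125) 0 → CleanlessExcessT →
CoherentResidual 10 → RobustDefectLimitWindows`. [this file] -/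
theorem rdef_of_ceg_tameMisfitGap (hCEG : ChargedEnergyGap) (hM : TameMisfitGap (122 / 125) 0) (hCE : CleanlessExcessT)
    (hRes : CoherentResidual 10) : RobustDefectLimitWindows :=
  rdef_of_ceg_misfitRelax (a := 122 / 125) (by norm_num) (by norm_num) hCEG (misfitRelax_of_tameMisfitGap (by norm_num) (by norm_num) hM)
    hCE hRes

/-- Cone XLI-W with TMG split: `ChargedEnergyGap → TameScaleGap (122/125) 0 → GapEnergyGap (122/125) 0 → CleanlessExcessT → CoherentResidual 10
→ RobustDefectLimitWindows`. [this file] -/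
theorem rdef_of_ceg_tameScale_gap (hCEG : ChargedEnergyGap) (hS : TameScaleGap (122 / 125) 0) (hG : GapEnergyGap (122 / 125) 0)
    (hCE : CleanlessExcessT) (hRes : CoherentResidual 10) : RobustDefectLimitWindows :=
  rdef_of_ceg_tameMisfitGap hCEG (tameMisfitGap_of_tameScale_gap hS hG) hCE hRes

/-- Cone XLI-W, geometric variant: `ChargedEnergyGap → TameScaleGap (122/125) 0 → GapFreeShells → CleanlessExcessT → CoherentResidual 10 →
RobustDefectLimitWindows`. [this file] -/
theorem rdef_of_ceg_tameScale_gapFree (hCEG : ChargedEnergyGap) (hS : TameScaleGap (122 / 125) 0) (hGF : GapFreeShells)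
    (hCE : CleanlessExcessT) (hRes : CoherentResidual 10) : RobustDefectLimitWindows :=
  rdef_of_ceg_tameMisfitGap hCEG (tameMisfitGap_zero_of_tameScale_gapFree hS hGF) hCE hRes

/-- `ChargedEnergyGap → TwoShellShape (1/100) ε g → RegisteredScaleGap (122/125) 0 ρ ε g → GapEnergyGap (122/125) 0 → CleanlessExcessT →
CoherentResidual 10 → RobustDefectLimitWindows` (`ρ ≥ 0`) — g38's cone WITHOUT its `NearChargeGap` slot. [this file] -/
theorem rdef_of_ceg_shape_registered_gap {ρ ε g : ℝ} (hρ : 0 ≤ ρ) (hCEG : ChargedEnergyGap) (hT : TwoShellShape (1 / 100) ε g)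
    (hR : RegisteredScaleGap (122 / 125) 0 ρ ε g) (hG : GapEnergyGap (122 / 125) 0) (hCE : CleanlessExcessT) (hRes : CoherentResidual 10) :
    RobustDefectLimitWindows :=
  rdef_of_ceg_tameScale_gap hCEG (tameScaleGap_of_registered hρ hT hR) hG hCE hRes

/-- **CONE XLIV — the record instance, SIX slots** (`ρ = 4`, shape literals `ε = 3/50`, `g = 1/450`): `ChargedEnergyGap →
TwoShellShape (1/100) (3/50) (1/450) → RegisteredScaleGap (122/125) 0 4 (3/50) (1/450) → GapFreeShells → CleanlessExcessT → CoherentResidual 10 →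
RobustDefectLimitWindows`.  Cone XLIII of g38 minus its rim slot `NearChargeGap (33/2)`, nothing in its place. [this file] -/
theorem rdef_of_ceg_shape_registered_gapFree (hCEG : ChargedEnergyGap) (hT : TwoShellShape (1 / 100) (3 / 50) (1 / 450))
    (hR : RegisteredScaleGap (122 / 125) 0 4 (3 / 50) (1 / 450)) (hGF : GapFreeShells) (hCE : CleanlessExcessT) (hRes : CoherentResidual 10) :
    RobustDefectLimitWindows :=
  rdef_of_ceg_tameScale_gapFree hCEG (tameScaleGap_of_registered (ρ := 4) (by norm_num) hT hR) hGF hCE hRes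

end Summit.AtomisticToContinuum.Crystallization.Theorems.OverbindingBudgetMisfitWindow
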